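import Literature.AnabelianGeometry.EtaleTheta.SettingModelTateOriginNegShear
import Literature.AnabelianGeometry.EtaleTheta.SettingModelTateThetaCusp
import HarnessLib

/-!
# The cusped stage-2 twin: `(ThetaSetting.modelχq′ p i j hj).IsTateOrigin ↔ j = 2 ∨ j = −2`, and `G_{K_N}` at `j = −2`

abc-iut cell, layer L2, R78 cluster STAGE 2, origin-profile lineage, seat abc-iut-w5-d051 (gen 3). Mochizuki, *The étale
theta function …*, Publ. RIMS **45** (2009) [EtTh], §1 p. 13 [cite: MochizukiEtTh2009, §1 p.13].

abc-iut-w5-d029's cusped record `ThetaSetting.modelχq′ p i j hj` shares `Π^tp_X`, `toZ`, `aug`, `q_X`, the theta layer and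
`Π^tp_{Y_N}` with abc-iut-L2-t5's `ThetaSetting.modelχq p i j hj` (all `rfl`), and `IsTateOrigin` does not read the cusp;
so the shear-rigidity IFF of `SettingModelTateOriginNegShear` TRANSPORTS verbatim:
* `modelχq'_isTateOrigin_iff` — `(modelχq′ p i j hj).IsTateOrigin ↔ j = 2 ∨ j = −2` (every `i`, every even `j`);
* `modelχq'_negTwo_isTateOrigin`; `modelχq_negTwo_gknIsKernelOfAction` / `modelχq'_negTwo_gknIsKernelOfAction` —
  «`G_{K_N} = Ker(G_K ↷ (Δ^tp_X)^ell/N·(Δ^tp_Y)^ell)`» for every `N` at the oppositely oriented models (from `IsTateOrigin`).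

PROOF-ONLY (no definition, no named fact). Semi-synthetic models = consistency evidence only; nothing of [EtTh] asserted
for genuine tempered fundamental groups; no side is taken on [IUTchIII] Cor. 3.12; typed ≠ proved.
-/

noncomputable section

namespace Literature.AnabelianGeometry.EtaleTheta.SettingModel

open Literature.AnabelianGeometry.SemiGraphs Thm16Sub Function Topology

variable (p : ℕ) [Fact p.Prime] (i j : ℤ) (hj : Even j)

/-- **`(modelχq′ p i j hj).IsTateOrigin ↔ j = 2 ∨ j = −2`** (transport of `modelχq_isTateOrigin_iff` along the shared
carriers). [cite: MochizukiEtTh2009, §1 p.13] -/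
theorem modelχq'_isTateOrigin_iff : (ThetaSetting.modelχq' p i j hj).IsTateOrigin ↔ j = 2 ∨ j = -2 :=
  ⟨fun h => (modelχq_isTateOrigin_iff p i j hj).mp ⟨h.tate⟩,
    fun h => ⟨((modelχq_isTateOrigin_iff p i j hj).mpr h).tate⟩⟩

/-- `IsTateOrigin` at the cusped model with the opposite orientation `j = −2`. [cite: MochizukiEtTh2009, §1 p.13] -/
theorem modelχq'_negTwo_isTateOrigin : (ThetaSetting.modelχq' p i (-2) (Even.neg even_two)).IsTateOrigin :=
  (modelχq'_isTateOrigin_iff p i (-2) (Even.neg even_two)).mpr (Or.inr rfl)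

/-- «`G_{K_N}` is the kernel of the action mod `N`» for every `N` at `modelχq p i (−2)`. [cite: MochizukiEtTh2009, §1 p.13] -/
theorem modelχq_negTwo_gknIsKernelOfAction (N : ℕ+) :
    GKNIsKernelOfAction (ThetaSetting.modelχq p i (-2) (Even.neg even_two)) N :=
  (modelχq_negTwo_isTateOrigin p i).gknIsKernelOfAction N

/-- The same at the cusped twin `modelχq′ p i (−2)`. [cite: MochizukiEtTh2009, §1 p.13] -/
theorem modelχq'_negTwo_gknIsKernelOfAction (N : ℕ+) :
    GKNIsKernelOfAction (ThetaSetting.modelχq' p i (-2) (Even.neg even_two)) N :=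
  (modelχq'_negTwo_isTateOrigin p i).gknIsKernelOfAction N

/-- **Summary**: across BOTH stage-2 carriers (cusp-free and cusped) and every inner exponent `i`, the print-faithful
Tate-module clause holds exactly at the shear exponents `j = ±2`. [cite: MochizukiEtTh2009, §1 p.13] -/
theorem stageTwo_isTateOrigin_iff :
    ((ThetaSetting.modelχq p i j hj).IsTateOrigin ↔ j = 2 ∨ j = -2) ∧
      ((ThetaSetting.modelχq' p i j hj).IsTateOrigin ↔ j = 2 ∨ j = -2) :=
  ⟨modelχq_isTateOrigin_iff p i j hj, modelχq'_isTateOrigin_iff p i j hj⟩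

end Literature.AnabelianGeometry.EtaleTheta.SettingModel

end
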